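import Summits.ABC.IUTFork.Joshi.TensorNormsNonArchCross
import Literature.Analysis.OperatorTheory.NonarchHahnBanach
import Mathlib.NumberTheory.Padics.ProperSpace
import HarnessLib

/-!
# Joshi's §7.6, part 7 (arXiv:2401.13508 v4, Thm 7.6.2.2 (2), PDF p. 62 l. 8–10): the injective norm on PURE tensors over a
# spherically complete field — PROVED (Ingleton); what remains of (2) is agreement OFF pure tensors

Record file of the abc-iut cell, branch E (rung LADDER-ABC:A2.E; seat abc-iut-E-t14, slot T-14). Source / bib (`Joshi2024ATS3`) /
framing as in `Joshi/TensorNorms.lean` (UNREFEREED preprint, disputed in print [Mochizuki2024JoshiReport]; typed ≠ proved ≠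
endorsed; no side taken; nothing here asserts abc or [IUTchIII] Cor. 3.12). What is PROVED here is classical.

Thm 7.6.2.2 (2) of [J-III] («over a p-adic field the projective and the injective tensor products coincide», [van der Put–van Tiel
1967, Thm 1]) is typed faithfully as the hypothesis `TensorNorm.ProjEqInjUltraClaim` (part 5, p432495): `injectiveNorm = maxProjNorm`
on ultrametric Banach families. THIS FILE proves its PURE-TENSOR part unconditionally: over a SPHERICALLY COMPLETE non-archimedean
field (every p-adic field) and for ultrametric (semi)normed factors, `injectiveNorm (⨂ₜ m) = ∏ ‖m_i‖ = maxProjNorm (⨂ₜ m)` — from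
part 3's bidual reduction `injectiveNorm_tprod_of_bidual` and the tree's Ingleton theorem
`Literature.Analysis.OperatorTheory.norm_inclusionInDoubleDual_eq_of_isSphericallyComplete` (abc-iut-found p430497); for the
p-adic-field encoding via `IsSphericallyComplete.of_finiteDimensional` (abc-iut-found p429154). So what (2) asserts BEYOND the tree is
exactly the agreement `ε = π_max` on NON-pure tensors (orthogonal-basis theory over spherically complete fields). Theorems only.
-/

noncomputable section

open scoped TensorProduct
open PiTensorProduct Literature.Analysis.OperatorTheory

universe u v w

namespace Summit.ABC.IUTFork.Joshi.TensorNorm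

section SphericallyComplete

variable {ι : Type*} [Fintype ι] {𝕜 : Type u} [NontriviallyNormedField 𝕜] [IsUltrametricDist 𝕜]
  {V : ι → Type v} [∀ i, SeminormedAddCommGroup (V i)] [∀ i, NormedSpace 𝕜 (V i)] [∀ i, IsUltrametricDist (V i)]

/-- **Injective norm of a pure tensor over a spherically complete field — PROVED**: `injectiveNorm (⨂ₜ m) = ∏ ‖m_i‖` for
ultrametric seminormed factors (part 3's `injectiveNorm_tprod_of_bidual` + Ingleton's bidual isometry
`norm_inclusionInDoubleDual_eq_of_isSphericallyComplete`). -/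
theorem injectiveNorm_tprod_of_isSphericallyComplete (h𝕜 : IsSphericallyComplete 𝕜) (m : Π i, V i) :
    injectiveNorm (⨂ₜ[𝕜] i, m i) = ∏ i, ‖m i‖ :=
  injectiveNorm_tprod_of_bidual m fun i => norm_inclusionInDoubleDual_eq_of_isSphericallyComplete h𝕜 (m i)

/-- **Thm 7.6.2.2 (2) ON PURE TENSORS — PROVED**: over a spherically complete non-archimedean field, `ε(⨂ₜ m) = π_max(⨂ₜ m)`
(`= ∏ ‖m_i‖`; `maxProjNorm_tprod_of_bidual`, part 4). The remaining content of (2) is the equality off pure tensors. -/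
theorem injectiveNorm_tprod_eq_maxProjNorm_of_isSphericallyComplete (h𝕜 : IsSphericallyComplete 𝕜) (m : Π i, V i) :
    injectiveNorm (⨂ₜ[𝕜] i, m i) = maxProjNorm (⨂ₜ[𝕜] i, m i) := by
  rw [injectiveNorm_tprod_of_isSphericallyComplete h𝕜,
    maxProjNorm_tprod_of_bidual m fun i => norm_inclusionInDoubleDual_eq_of_isSphericallyComplete h𝕜 (m i)]

/-- The injective norm is cross (part 1's `HasCrossNorm`) over a spherically complete field, for ultrametric factors. -/
theorem hasCrossNorm_injectiveNorm_of_isSphericallyComplete (h𝕜 : IsSphericallyComplete 𝕜) :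
    HasCrossNorm (injectiveNorm (𝕜 := 𝕜) (V := V)) :=
  injectiveNorm_tprod_of_isSphericallyComplete h𝕜

end SphericallyComplete

section PadicField

variable (p : ℕ) [Fact p.Prime] (E : Type) [NontriviallyNormedField E] [NormedAlgebra ℚ_[p] E]

/-- **Thm 7.6.2.2 (2) on pure tensors for the p-adic-field encoding — PROVED**: for `E` a finite-dimensional normed `ℚ_p`-algebra that
is a field (spherically complete by `IsSphericallyComplete.of_finiteDimensional`, ultrametric by `isUltrametricDist_of_normedAlgebra_padic`)
and ultrametric seminormed factors: `injectiveNorm (⨂ₜ m) = ∏ ‖m_i‖`. -/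
theorem injectiveNorm_tprod_padicField [FiniteDimensional ℚ_[p] E] {ι : Type v} [Fintype ι] (V : ι → Type w)
    [∀ i, SeminormedAddCommGroup (V i)] [∀ i, NormedSpace E (V i)] [∀ i, IsUltrametricDist (V i)] (m : Π i, V i) :
    injectiveNorm (⨂ₜ[E] i, m i) = ∏ i, ‖m i‖ := by
  haveI : IsUltrametricDist E := isUltrametricDist_of_normedAlgebra_padic p E
  exact injectiveNorm_tprod_of_isSphericallyComplete (IsSphericallyComplete.of_finiteDimensional ℚ_[p] E) m

variable {p E} in
/-- Under the faithful (2) (`ProjEqInjUltraClaim`, hypothesis) nothing new happens on pure tensors: both sides equal `∏ ‖m_i‖`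
unconditionally (`injectiveNorm_tprod_padicField`, `maxProjNorm_tprod_padicField`) — the hypothesis only bites off pure tensors. -/
theorem projEqInj_on_tprod_padicField [FiniteDimensional ℚ_[p] E] {ι : Type v} [Fintype ι] (V : ι → Type w)
    [∀ i, NormedAddCommGroup (V i)] [∀ i, NormedSpace E (V i)] [∀ i, IsUltrametricDist (V i)] (m : Π i, V i) :
    injectiveNorm (⨂ₜ[E] i, m i) = maxProjNorm (⨂ₜ[E] i, m i) := by
  rw [injectiveNorm_tprod_padicField p E V m, maxProjNorm_tprod_padicField p E V m]

end PadicField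

end Summit.ABC.IUTFork.Joshi.TensorNorm

end
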